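import Literature.Geometry.Lorentzian.QuasiFinalAnalytic
import Literature.Geometry.Lorentzian.CausallyConvexAchronalCore
import HarnessLib

/-!
# The late chart is built on a Cauchy temporal function (Ellithy 2026, §4.1; Bernal–Sánchez 2006)

A. Ellithy, *The spacetime Penrose inequality under a quasi final state hypothesis*,
arXiv:2605.18730 (2026), §4.1 (p. 38) and Definitions 4.3/4.4 (p. 39); A. N. Bernal, M. Sánchez,
*Further results on the smoothability of Cauchy hypersurfaces and Cauchy time functions*,
Lett. Math. Phys. 77 (2006) 183–197 (arXiv:gr-qc/0512095), §2 (p. 3).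

**Ellithy 2026, §4.1** (p. 38): "We then choose a smooth Cauchy temporal function
`t : 𝓜̂ → ℝ` whose level sets `Σ_t := {t = const}` are asymptotically Euclidean Cauchy hypersurfaces
adapted to this rest-frame asymptotic coordinate system. The existence of smooth Cauchy temporal
functions on globally hyperbolic spacetimes, and the corresponding smooth splitting by spacelike
Cauchy hypersurfaces, is due to Bernal–Sánchez".  The late chart `(t, r, p)` of Definitions 4.3/4.4
(p. 39) uses THIS `t` as its time coordinate: "The horizon sections
`𝒮_t = 𝓗_final ∩ Σ_t = {t} × {r₀} × S²`" (Def. 4.3, p. 39), i.e. the chart slices `{t} × [r₀, ∞) × S²`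
lie in the Cauchy hypersurfaces `Σ_t`.

**Bernal–Sánchez 2006, §2** (p. 3): "A time function is a continuous function `t` which increases
strictly on any future-directed causal curve. A temporal function is a smooth function with
past-directed timelike gradient everywhere. Temporal functions are always time functions … Time
and temporal functions will be called Cauchy if their levels are Cauchy hypersurfaces."

The typed analytic clauses `IsQuasiFinalAnalytic I g Φ T̲ r₀`
(`Literature.Geometry.Lorentzian.QuasiFinalAnalytic`) carry no orientation clause: the ADM form is
quadratic in the lapse and does not say that the chart time `t` increases towards the future, nor
that its slices are Cauchy.  This module types the two printed sentences above:

* `LorentzianMetric.IsTemporalFunction g τ 𝓣` — `𝓣` is `Cⁿ` (the smoothness exponent of the metric;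
  "smooth" in print) and `d𝓣(v) > 0` for every future-directed causal `v` (the rendering of
  "past-directed timelike gradient": `g(∇𝓣, v) = d𝓣(v)`, and a vector has positive product with
  every future-directed causal vector iff it is past-directed timelike — the same rendering as the
  tree's Bernard–Suhr facts, `CauchyTemporalTwoLevels`);
* `LorentzianMetric.IsCauchyTemporalFunction g τ 𝓣` — temporal with every level `𝓣⁻¹(c)` a Cauchy
  hypersurface (`LorentzianMetric.IsCauchyHypersurface`, O'Neill's Def. 14.28 as vendored);
* `IsChartTime 𝓣 Φ T̲ r₀` — the late chart's time coordinate IS `𝓣`: `𝓣(Φ(t, r, p)) = t` for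
  `t > T̲`, `r ≥ r₀` (read through `polarChart`, as `HasADMForm` reads the chart);
* `IsQuasiFinalTemporalChart g τ 𝓣 Φ T̲ r₀` — both together (§4.1 + Def. 4.4's chart).

API: a temporal function is a time function on every region in the tree's sense
`LorentzianMetric.IsTimeFunctionOn` (`IsTemporalFunction.isTimeFunctionOn`, Bernal–Sánchez loc. cit.
"Temporal functions are always time functions"; chain rule + mean value theorem, cf. the tree's
`LorentzianMetric.strictMonoOn_comp_of_mfderiv_pos`); along a late label line `s ↦ Φ(s, r, p)` the
temporal function is the parameter (`IsChartTime.apply_polarChart`), so label lines are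
parametrised by Cauchy time (`IsQuasiFinalTemporalChart.strictMono_label`).

Typing a definition proves nothing: no fact of either paper is stated here.

## References

* [Ellithy2026] A. Ellithy, arXiv:2605.18730 (2026), §4.1 (p. 38), Defs. 4.3/4.4 (p. 39).
* [BernalSanchez2006] A. N. Bernal, M. Sánchez, Lett. Math. Phys. 77 (2006) 183–197, §2 (p. 3).
-/

noncomputable section

open Set Metric Function
open scoped Manifold ContDiff Topology

namespace Literature.Geometry.Lorentzian

namespace LorentzianMetric

variable {E : Type*} [NormedAddCommGroup E] [NormedSpace ℝ E] {H : Type*} [TopologicalSpace H]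
  {I : ModelWithCorners ℝ E H} {n : ℕ∞ω} {M : Type*} [TopologicalSpace M] [ChartedSpace H M]
  [IsManifold I ∞ M]

/-- **Temporal function** (Bernal–Sánchez 2006, §2, p. 3: "a smooth function with past-directed
timelike gradient everywhere"): `𝓣 : M → ℝ` is `Cⁿ` and `d𝓣ₓ(v) > 0` for every future-directed
causal vector `v ∈ TₓM` (`g(∇𝓣, v) = d𝓣(v)`; positivity against all future-directed causal `v` is
past-directed timelikeness of `∇𝓣`). [cite: BernalSanchez2006, §2 p. 3] -/
def IsTemporalFunction (g : LorentzianMetric I n M) (τ : TimeOrientation g) (𝓣 : M → ℝ) : Prop :=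
  ContMDiff I 𝓘(ℝ, ℝ) n 𝓣 ∧
    ∀ (x : M) (v : TangentSpace I x), τ.IsFutureDirected v → (0 : ℝ) < mfderiv I 𝓘(ℝ, ℝ) 𝓣 x v

/-- **Cauchy temporal function** (Bernal–Sánchez 2006, §2, p. 3: "Time and temporal functions will
be called Cauchy if their levels are Cauchy hypersurfaces"; Ellithy 2026, §4.1, p. 38: "a smooth
Cauchy temporal function `t : 𝓜̂ → ℝ` whose level sets `Σ_t := {t = const}` are … Cauchy
hypersurfaces"): a temporal function every level `𝓣⁻¹(c)` of which is a Cauchy hypersurface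
(`IsCauchyHypersurface`: met exactly once by every endless timelike curve).
[cite: BernalSanchez2006, §2 p. 3] -/
def IsCauchyTemporalFunction (g : LorentzianMetric I n M) (τ : TimeOrientation g) (𝓣 : M → ℝ) :
    Prop :=
  g.IsTemporalFunction τ 𝓣 ∧ ∀ c : ℝ, g.IsCauchyHypersurface τ (𝓣 ⁻¹' {c})

variable {g : LorentzianMetric I n M} {τ : TimeOrientation g} {𝓣 : M → ℝ}

/-- Unpacking: a temporal function is `Cⁿ`. [cite: BernalSanchez2006, §2 p. 3] -/
theorem IsTemporalFunction.contMDiff (h : g.IsTemporalFunction τ 𝓣) : ContMDiff I 𝓘(ℝ, ℝ) n 𝓣 :=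
  h.1

/-- Unpacking: `d𝓣(v) > 0` on future-directed causal vectors. [cite: BernalSanchez2006, §2 p. 3] -/
theorem IsTemporalFunction.mfderiv_pos (h : g.IsTemporalFunction τ 𝓣) {x : M} {v : TangentSpace I x}
    (hv : τ.IsFutureDirected v) : (0 : ℝ) < mfderiv I 𝓘(ℝ, ℝ) 𝓣 x v :=
  h.2 x v hv

/-- Unpacking: a Cauchy temporal function is temporal. [cite: BernalSanchez2006, §2 p. 3] -/
theorem IsCauchyTemporalFunction.isTemporalFunction (h : g.IsCauchyTemporalFunction τ 𝓣) :
    g.IsTemporalFunction τ 𝓣 :=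
  h.1

/-- Unpacking: the levels of a Cauchy temporal function are Cauchy hypersurfaces.
[cite: BernalSanchez2006, §2 p. 3] -/
theorem IsCauchyTemporalFunction.isCauchyHypersurface_level (h : g.IsCauchyTemporalFunction τ 𝓣)
    (c : ℝ) : g.IsCauchyHypersurface τ (𝓣 ⁻¹' {c}) :=
  h.2 c

/-- **"Temporal functions are always time functions"** (Bernal–Sánchez 2006, §2, p. 3): along a
future causal curve `γ` on `[a, b]`, `a < b`, one has `𝓣(γ a) < 𝓣(γ b)` — for `n ≥ 1`, in the
tree's sense `IsTimeFunctionOn g τ 𝓣 R` on every region `R` (chain rule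
`(𝓣 ∘ γ)' = d𝓣(γ') > 0` and the mean value theorem; cf. `strictMonoOn_comp_of_mfderiv_pos`).
[cite: BernalSanchez2006, §2 p. 3] -/
theorem IsTemporalFunction.isTimeFunctionOn (h : g.IsTemporalFunction τ 𝓣) (hn : 1 ≤ n)
    (R : Set M) : IsTimeFunctionOn g τ 𝓣 R := by
  intro γ a b hab hγ _
  have hd : ∀ s ∈ Icc a b,
      HasDerivAt (𝓣 ∘ γ) (mfderiv I 𝓘(ℝ, ℝ) 𝓣 (γ s) (velocity I γ s)) s := by
    intro s hs
    have h𝓣 : MDifferentiableAt I 𝓘(ℝ, ℝ) 𝓣 (γ s) := (h.1.of_le hn).mdifferentiableAt one_ne_zero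
    have h₂ := h𝓣.hasMFDerivAt.comp s (hγ s hs).1.hasMFDerivAt
    rw [hasMFDerivAt_iff_hasFDerivAt] at h₂
    set L : ℝ →L[ℝ] ℝ := (mfderiv I 𝓘(ℝ, ℝ) 𝓣 (γ s)).comp (mfderiv 𝓘(ℝ, ℝ) I γ s) with hL
    have h₃ : HasFDerivAt (𝓣 ∘ γ) L s := h₂
    exact h₃.hasDerivAt
  have hmono : StrictMonoOn (𝓣 ∘ γ) (Icc a b) := by
    refine strictMonoOn_of_deriv_pos (convex_Icc a b)
      (fun s hs ↦ (hd s hs).continuousAt.continuousWithinAt) fun s hs ↦ ?_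
    have hs' : s ∈ Icc a b := interior_subset hs
    rw [(hd s hs').deriv]
    exact h.2 _ _ (hγ s hs').2
  exact hmono (left_mem_Icc.mpr hab.le) (right_mem_Icc.mpr hab.le) hab

end LorentzianMetric

/-! ### The late chart's time coordinate is the Cauchy temporal function -/

section ChartTime

variable {M : Type*}

/-- **The chart time is the global time function** (Ellithy 2026, §4.1, p. 38 with Defs. 4.3/4.4,
p. 39: the late chart `(t, r, p) ∈ (T̲, ∞) × [r₀, ∞) × S²` has its `t`-slices inside the level sets
`Σ_t = {t = const}` of the chosen Cauchy temporal function, "`𝒮_t = 𝓗_final ∩ Σ_t =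
{t} × {r₀} × S²`"): `𝓣(Φ(t, r, p)) = t` for `t > T̲` and `r ≥ r₀`, read through the Cartesian slice
coordinates `y = r p` (`polarChart`). [cite: Ellithy2026, §4.1 p. 38; Def. 4.3/4.4 p. 39] -/
def IsChartTime (𝓣 : M → ℝ) (Φ : ℝ × ℝ × sphere (0 : E3) 1 → M) (Tlo r₀ : ℝ) : Prop :=
  ∀ (t : ℝ) (y : E3), Tlo < t → r₀ ≤ ‖y‖ → 𝓣 (polarChart Φ (t, y)) = t

variable {𝓣 : M → ℝ} {Φ : ℝ × ℝ × sphere (0 : E3) 1 → M} {Tlo r₀ : ℝ}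

/-- Unpacking `IsChartTime` at a chart point. [cite: Ellithy2026, §4.1 p. 38] -/
theorem IsChartTime.apply_polarChart (h : IsChartTime 𝓣 Φ Tlo r₀) {t : ℝ} {y : E3} (ht : Tlo < t)
    (hy : r₀ ≤ ‖y‖) : 𝓣 (polarChart Φ (t, y)) = t :=
  h t y ht hy

/-- A chart time after `T̲` is a chart time after any later `T̲' ≥ T̲` and on any smaller exterior
`r ≥ r₀' ≥ r₀`. [cite: Ellithy2026, §4.1 p. 38] -/
theorem IsChartTime.mono (h : IsChartTime 𝓣 Φ Tlo r₀) {Tlo' r₀' : ℝ} (hT : Tlo ≤ Tlo')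
    (hr : r₀ ≤ r₀') : IsChartTime 𝓣 Φ Tlo' r₀' :=
  fun t y ht hy ↦ h t y (hT.trans_lt ht) (hr.trans hy)

/-- The chart slice `{t} × {r ≥ r₀}` lies in the level set `Σ_t = 𝓣⁻¹(t)`.
[cite: Ellithy2026, §4.1 p. 38; Def. 4.3 p. 39] -/
theorem IsChartTime.polarChart_mem_level (h : IsChartTime 𝓣 Φ Tlo r₀) {t : ℝ} {y : E3} (ht : Tlo < t)
    (hy : r₀ ≤ ‖y‖) : polarChart Φ (t, y) ∈ 𝓣 ⁻¹' {t} :=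
  h t y ht hy

/-- **Late label lines are parametrised by Cauchy time**: along `s ↦ Φ(s, r, p)` (fixed `y = r p`,
`r ≥ r₀`) the temporal function is strictly increasing on `(T̲, ∞)` — indeed equal to the
parameter. [cite: Ellithy2026, §4.1 p. 38] -/
theorem IsChartTime.strictMonoOn_label (h : IsChartTime 𝓣 Φ Tlo r₀) {y : E3} (hy : r₀ ≤ ‖y‖) :
    StrictMonoOn (fun s : ℝ ↦ 𝓣 (polarChart Φ (s, y))) (Ioi Tlo) := by
  intro s hs s' hs' hss'
  simp only [h s y hs hy, h s' y hs' hy]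
  exact hss'

end ChartTime

section TemporalChart

variable {EM : Type*} [NormedAddCommGroup EM] [NormedSpace ℝ EM] {HM : Type*}
  [TopologicalSpace HM] {I : ModelWithCorners ℝ EM HM} {n : ℕ∞ω} {M : Type*} [TopologicalSpace M]
  [ChartedSpace HM M] [IsManifold I ∞ M]

/-- **§4.1's temporal setting for the late chart of Def. 4.4**: `𝓣` is a smooth Cauchy temporal
function of `(M, g, τ)` and the chart's time coordinate is `𝓣`.
[cite: Ellithy2026, §4.1 p. 38; Def. 4.4 p. 39] -/
def IsQuasiFinalTemporalChart (g : LorentzianMetric I n M) (τ : TimeOrientation g) (𝓣 : M → ℝ)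
    (Φ : ℝ × ℝ × sphere (0 : E3) 1 → M) (Tlo r₀ : ℝ) : Prop :=
  g.IsCauchyTemporalFunction τ 𝓣 ∧ IsChartTime 𝓣 Φ Tlo r₀

variable {𝓣 : M → ℝ} {Φ : ℝ × ℝ × sphere (0 : E3) 1 → M} {Tlo r₀ : ℝ}
variable {g : LorentzianMetric I n M} {τ : TimeOrientation g}

/-- Unpacking the assembled predicate. [cite: Ellithy2026, §4.1 p. 38] -/
theorem IsQuasiFinalTemporalChart.isCauchyTemporalFunction
    (h : IsQuasiFinalTemporalChart g τ 𝓣 Φ Tlo r₀) : g.IsCauchyTemporalFunction τ 𝓣 :=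
  h.1

/-- Unpacking the assembled predicate. [cite: Ellithy2026, §4.1 p. 38] -/
theorem IsQuasiFinalTemporalChart.isChartTime (h : IsQuasiFinalTemporalChart g τ 𝓣 Φ Tlo r₀) :
    IsChartTime 𝓣 Φ Tlo r₀ :=
  h.2

/-- The late chart slices `Φ({t} × {r ≥ r₀})`, `t > T̲`, lie in Cauchy hypersurfaces (the levels
`Σ_t` of the Cauchy temporal function). [cite: Ellithy2026, §4.1 p. 38] -/
theorem IsQuasiFinalTemporalChart.exists_cauchy_slice (h : IsQuasiFinalTemporalChart g τ 𝓣 Φ Tlo r₀)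
    {t : ℝ} (ht : Tlo < t) :
    ∃ S : Set M, g.IsCauchyHypersurface τ S ∧ ∀ y : E3, r₀ ≤ ‖y‖ → polarChart Φ (t, y) ∈ S :=
  ⟨𝓣 ⁻¹' {t}, h.1.2 t, fun y hy ↦ h.2 t y ht hy⟩

end TemporalChart

end Literature.Geometry.Lorentzian

end
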